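import Literature.AlgebraicGeometry.Resolution.RidgeAlgebraDirects
import HarnessLib

/-!
# `S = K[X]` is free over the algebra `U = K[σ_1, …, σ_r]` of a triangular system of additive forms, on the standard
# monomials (Berthomieu–Hivert–Mourtada 2010 Cor. 2.9, "left to the reader"; Hironaka 1970) — in particular over
# Giraud's algebra of invariants of the ridge

Topic: `Literature/AlgebraicGeometry/Resolution`. Sequel of `TriangularStandardMonomials.lean` (standard monomials
`X^b`, `b_{ι(j)} < q_j`, of a triangular presentation `U = K[σ_1, …, σ_r]`, `σ_j = X_{ι(j)}^{q_j} + …`; `S = Σ_b U X^b`,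
`mem_stdSpan`) and `RidgeAlgebraDirects.lean` (the peeling theorem `mem_of_sum_mul_monomial_mem`: if the universal
point of `V(σ)` lies in the ridge of `I` and `Σ_b u_b X^b ∈ I` with `u_b ∈ U`, then all `u_b ∈ I`).

> **Giraud 1975, §1.6 (after Hironaka 1970).** "quitte à changer l'ordre des variables `X_α`, on peut modifier les
> `S_i` de manière à avoir un système triangulaire (3) `S_i = X_i^{q(i)} + Σ_{j>i} S_{ij} X_j^{q(i)}` … (4) `Z_i = X_i`
> pour `1 ≤ i ≤ e` et `W_i = X_{i+e}`"; §1.5: "`U` est l'algèbre des invariants de `F`, c'est-à-dire, par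
> définition, l'algèbre des fonctions sur le quotient `V/F`". **Berthomieu–Hivert–Mourtada 2010, Corollary 2.9**:
> "With notations as above [`U = k[θ_1, …, θ_s]`, `θ_i = X_i^{p^{α_i}} + t_i(X_{i+1}, …, X_n)` triangular], `R` is a free
> module over `U` of basis [the monomials `X^B`, `B_i < p^{α_i}`]. Proof. Left to the reader." (and "`R` is
> faithfully flat over `U` (see Corollary 2.9)" in the proof of Prop. 2.10); Cor. 2.8: `U` is a polynomial algebra.

PROVED here, as the case `I = (0)` of the peeling theorem (the ridge of the zero ideal is the whole vector group, so
its hypothesis is vacuous): **`linearIndependent_monomial_isTriStd`** — the standard monomials are linearly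
independent over `U`; **`basisStd`** — they form a `U`-BASIS of `S` (`basisStd_apply`); hence `Module.Free U S`
(`free_of_triangularPresentation`) and, for every ideal `I` and Giraud's algebra of invariants of its ridge,
**`free_ridgeAlgebra : Module.Free (ridgeAlgebra p I) S`** (a triangular presentation of the graded
Hasse–Schmidt-stable algebra `ridgeAlgebra p I` exists over any field, `nonempty_triangularPresentation`).

Written for the cell res-hironaka (W4.6 rung (iv) support, seat res-L1-s46-pv-7 gen 4). AI-written; AI review is
weaker than expert review.

## References

* H. Hironaka, *Additive groups associated with points of a projective space*, Ann. of Math. 92 (1970) 327–334.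
  [Hironaka1970AdditiveGroups]
* J. Giraud, *Contact maximal en caractéristique positive*, Ann. Sci. ÉNS (4) 8 (1975) 201–234, §1.5–1.6 p.204.
  [Giraud1975]
* J. Berthomieu, P. Hivert, H. Mourtada, *Computing Hironaka's invariants: ridge and directrix*, Contemp. Math. 521
  (2010) 9–20, Cor. 2.8, Cor. 2.9, proof of Prop. 2.10. [BerthomieuHivertMourtada2010]
-/

noncomputable section

open MvPolynomial
open Literature.AlgebraicGeometry.Hironaka2017.EdgeAlgebra

namespace Literature.AlgebraicGeometry.Resolution

universe u

variable {K : Type u} [Field K] {n : ℕ} {p : ℕ} [ExpChar K p]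
variable {U : Subalgebra K (MvPolynomial (Fin n) K)}

/-- The ridge of the zero ideal (the cone `C = V` itself) is the whole vector group. [cite: Giraud1975, §1.5] -/
private theorem mem_ridge_bot {k' : Type u} [CommRing k'] [Algebra K k'] (v : Fin n → k') :
    v ∈ ridge k' (⊥ : Ideal (MvPolynomial (Fin n) K)) := by
  rw [mem_ridge_iff_forall_mem]
  intro f hf
  rw [(Submodule.mem_bot _).mp hf, map_zero, map_zero]
  exact Ideal.zero_mem _

/-- **The standard monomials are linearly independent over `U = K[σ_1, …, σ_r]`** (the case `I = (0)` of the peeling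
theorem of `RidgeAlgebraDirects.lean`: `Σ_b u_b X^b = 0`, `u_b ∈ U` ⇒ `u_b ∈ (0)`). [cite: BerthomieuHivertMourtada2010, Cor. 2.9] -/
theorem linearIndependent_monomial_isTriStd (P : TriangularPresentation p U) :
    LinearIndependent U (fun b : {b : Fin n →₀ ℕ // IsTriStd P b} => (monomial b.1 (1 : K) : MvPolynomial (Fin n) K)) := by
  classical
  rw [linearIndependent_iff']
  intro t g hsum i hi
  -- rewrite the relation as `Σ_{b ∈ t.map val} u_b X^b = 0` with `u_b ∈ U`
  set u : (Fin n →₀ ℕ) → MvPolynomial (Fin n) K := fun b => if h : IsTriStd P b then (g ⟨b, h⟩ : MvPolynomial (Fin n) K) else 0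
    with hu
  have hsum' : (∑ b ∈ t.map (Function.Embedding.subtype _), u b * monomial b 1) ∈ (⊥ : Ideal (MvPolynomial (Fin n) K)) := by
    rw [Finset.sum_map, Submodule.mem_bot]
    rw [← hsum]
    refine Finset.sum_congr rfl fun b _ => ?_
    rw [hu]
    simp only [Function.Embedding.coe_subtype, dif_pos b.2, Subalgebra.smul_def, smul_eq_mul]
  have hx : uPoint (triIdeal P) ∈ ridge (MvPolynomial (Fin n) K ⧸ triIdeal P) (⊥ : Ideal (MvPolynomial (Fin n) K)) :=
    mem_ridge_bot _
  have hall := mem_of_sum_mul_monomial_mem (I := ⊥) P hx (t.map (Function.Embedding.subtype _))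
    (fun b hb => by
      obtain ⟨b', -, rfl⟩ := Finset.mem_map.mp hb
      exact b'.2)
    u (fun b hb => by
      obtain ⟨b', -, rfl⟩ := Finset.mem_map.mp hb
      rw [hu]; simp only [Function.Embedding.coe_subtype, dif_pos b'.2]
      exact (g b').2) hsum'
  have hi' : u i.1 ∈ (⊥ : Ideal (MvPolynomial (Fin n) K)) :=
    hall i.1 (Finset.mem_map.mpr ⟨i, hi, rfl⟩)
  rw [hu] at hi'
  simp only [dif_pos i.2, Submodule.mem_bot, ZeroMemClass.coe_eq_zero] at hi'
  exact hi'

/-- **The standard monomials form a `U`-basis of `S`** (independent and spanning, `mem_stdSpan`).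
[cite: BerthomieuHivertMourtada2010, Cor. 2.9] -/
def basisStd (P : TriangularPresentation p U) : Module.Basis {b : Fin n →₀ ℕ // IsTriStd P b} U (MvPolynomial (Fin n) K) :=
  Module.Basis.mk (linearIndependent_monomial_isTriStd P) (by
    rintro f -
    have h := mem_stdSpan P f
    rw [stdSpan] at h
    refine Submodule.span_mono ?_ h
    rintro _ ⟨b, hb, rfl⟩
    exact ⟨⟨b, hb⟩, rfl⟩)

/-- The basis vectors are the standard monomials. [cite: BerthomieuHivertMourtada2010, Cor. 2.9] -/
theorem basisStd_apply (P : TriangularPresentation p U) (b : {b : Fin n →₀ ℕ // IsTriStd P b}) :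
    basisStd P b = monomial b.1 (1 : K) := by
  rw [basisStd, Module.Basis.mk_apply]

/-- **`S` is a free `U`-module** for every subalgebra `U` with a triangular presentation.
[cite: BerthomieuHivertMourtada2010, Cor. 2.9] -/
theorem free_of_triangularPresentation (P : TriangularPresentation p U) : Module.Free U (MvPolynomial (Fin n) K) :=
  Module.Free.of_basis (basisStd P)

/-- **Uniqueness of the expansion `f = Σ_b u_b X^b`** over standard `b` with `u_b ∈ U`: the coefficient of `X^b` is
`(basisStd P).repr f b`. [cite: BerthomieuHivertMourtada2010, Cor. 2.9] -/
theorem repr_eq_of_sum_eq (P : TriangularPresentation p U) (l : {b : Fin n →₀ ℕ // IsTriStd P b} →₀ U)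
    {f : MvPolynomial (Fin n) K}
    (hf : f = ∑ b ∈ l.support, (l b : MvPolynomial (Fin n) K) * monomial b.1 1) :
    (basisStd P).repr f = l := by
  classical
  have : f = Finsupp.linearCombination U (basisStd P) l := by
    rw [hf, Finsupp.linearCombination_apply, Finsupp.sum]
    refine Finset.sum_congr rfl fun b _ => ?_
    rw [basisStd_apply, Subalgebra.smul_def, smul_eq_mul]
  rw [this, Module.Basis.repr_linearCombination]

/-- **`S` is free over Giraud's algebra of invariants `U = ridgeAlgebra p I` of the ridge of ANY ideal `I`** (a graded
Hasse–Schmidt-stable algebra generated by additive forms, hence triangularly presented over any field — Hironaka 1970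
for perfect fields, Giraud 1975 §1.6 in general). [cite: Giraud1975, §1.6 (3) p.204] -/
theorem free_ridgeAlgebra (I : Ideal (MvPolynomial (Fin n) K)) :
    Module.Free (ridgeAlgebra p I) (MvPolynomial (Fin n) K) := by
  obtain ⟨P⟩ := nonempty_triangularPresentation p (ridgeAlgebra p I) (isGradedSubalgebra_ridgeAlgebra p I)
    (isDiffStable_ridgeAlgebra p I)
  exact free_of_triangularPresentation P

end Literature.AlgebraicGeometry.Resolution

end
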